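import Literature.Probability.Percolation.TripodExchange
import HarnessLib

/-!
# The master two-cut inequality behind the lonely-relay lemma, and the heavy-class exit bound

Helpers for the crux `NoHeavyLowerTail` (stmt-CriticalPhenomena-4575; routes `PercNearOneGluing`,
`PercNearOneGluingNoHeavy`), line `one-cut` / blob-quotient analysis (depth prover nh-dp-blobmono).

Bond percolation `μ = prodBernoulli w` with arbitrary edge probabilities on a finite vertex type `V`; an
observer `o` and three relays `a, b, c` (no distinctness assumed).  With the four cells of the tripod
exchange inequality C⁺ (`Literature.Probability.Percolation.tripodExchange`, x = a, y = b, z = c)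
`E₁ = {o↔a}∩{b↔c}∩{a↮b}` (= `oa|bc`), `E₂ = {o↔b}∩{a↔c}∩{a↮b}` (= `ob|ac`),
`E₃ = {o↔a}∩{a↔c}∩{a↮b}` (= `oac|b`), `E₄ = {o↔b}∩{b↔c}∩{a↮b}` (= `obc|a`), C⁺ reads
`μE₁ · μE₂ ≤ μE₃ · μE₄`.  This file PROVES:

* `twoCutMaster_le` — the MASTER INEQUALITY
  `μ( ({a↮c} ∩ {b↮c}) ∪ E₁ ∪ E₂ ) ≤ max(μ{a↮c}, μ{b↮c})` (slack form: both cuts `≤ t` ⇒ `≤ t`).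
  In words: the event "c is cut from both a and b, or the four points sit in one of the two alternating
  2+2 patterns `oa|bc`, `ob|ac`" is never more likely than the worse of the two single cuts from `c`.
  Proof: the event meets `{b↔c}` inside `E₁` and misses `E₃ ⊆ {b↮c}`, so its mass is
  `≤ μ{b↮c} − μE₃ + μE₁`; symmetrically `≤ μ{a↮c} − μE₄ + μE₂`; if it exceeded both cuts then
  `μE₃ < μE₁`, `μE₄ < μE₂`, so `μE₃μE₄ < μE₁μE₂`, contradicting C⁺.
* `lonelyOrPair_le` — monotone corollary used by the 4-class ("four blobs") case of the one-cut bound with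
  a heavy class `c` and an observer class without targets (sub-case R4b of the blob analysis):
  `μ( {o↮c} ∩ ({o↔a} ∪ {o↔b}) ) ≤ max(μ{a↮c}, μ{b↮c})`.
  (The lonely-relay lemma `Theorems.lonelyRelay_three` of `…OneCutThree.lean` is the other monotone
  corollary: `{N = 1} ⊆` the master event.)

No definition is introduced; trust base = the kernel (C⁺ is proved in the tree from
van den Berg–Häggström–Kahn 2006, Thm. 1.5).

## References

* J. van den Berg, O. Häggström, J. Kahn, Random Structures Algorithms 29 (2006) 417–435, Thm. 1.5
  — source of C⁺. [VandenbergHaggstromKahn2005]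
* G. Kozma, S. Nitzan, arXiv:2401.12397 (2024), Conjecture 3 — the route's thesis. [KozmaNitzan2024]
-/

noncomputable section

open MeasureTheory Set
open Literature.Probability.LatticeModels (prodBernoulli)
open Literature.Probability.Percolation

namespace Summit.CriticalPhenomena.PercolationContinuityZ3.Theorems

variable {V : Type*}

/-- The master event meets `{b ↔ c}` inside `oa|bc` and misses `oac|b`:
`(({a↮c}∩{b↮c}) ∪ oa|bc ∪ ob|ac) ⊆ ({b↮c} \ oac|b) ∪ oa|bc`. [folklore] -/
theorem twoCutMaster_subset_left (o a b c : V) :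
    ((((openConn a c)ᶜ ∩ (openConn b c)ᶜ) ∪ (openConn o a ∩ openConn b c ∩ (openConn a b)ᶜ)) ∪
        (openConn o b ∩ openConn a c ∩ (openConn a b)ᶜ) : Set (BondConfig V)) ⊆
      ((openConn b c)ᶜ \ (openConn o a ∩ openConn a c ∩ (openConn a b)ᶜ)) ∪
        (openConn o a ∩ openConn b c ∩ (openConn a b)ᶜ) := by
  intro ω hω
  have mem : ∀ x y : V, ω ∈ (openConn x y : Set (BondConfig V)) ↔ (openGraph ω).Reachable x y :=
    fun _ _ => Iff.rfl
  simp only [mem_union, mem_inter_iff, mem_compl_iff, mem] at hω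
  simp only [mem_union, mem_sdiff, mem_compl_iff, mem_inter_iff, mem]
  rcases hω with (⟨hac, hbc⟩ | ⟨⟨hoa, hbc⟩, hab⟩) | ⟨⟨hob, hac⟩, hab⟩
  · left
    exact ⟨hbc, fun h => hac h.1.2⟩
  · right
    exact ⟨⟨hoa, hbc⟩, hab⟩
  · left
    refine ⟨fun hbc => hab (hac.trans hbc.symm), ?_⟩
    rintro ⟨⟨hoa, -⟩, -⟩
    exact hab (hoa.symm.trans hob)

/-- Symmetrically, the master event meets `{a ↔ c}` inside `ob|ac` and misses `obc|a`:
`(({a↮c}∩{b↮c}) ∪ oa|bc ∪ ob|ac) ⊆ ({a↮c} \ obc|a) ∪ ob|ac`. [folklore] -/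
theorem twoCutMaster_subset_right (o a b c : V) :
    ((((openConn a c)ᶜ ∩ (openConn b c)ᶜ) ∪ (openConn o a ∩ openConn b c ∩ (openConn a b)ᶜ)) ∪
        (openConn o b ∩ openConn a c ∩ (openConn a b)ᶜ) : Set (BondConfig V)) ⊆
      ((openConn a c)ᶜ \ (openConn o b ∩ openConn b c ∩ (openConn a b)ᶜ)) ∪
        (openConn o b ∩ openConn a c ∩ (openConn a b)ᶜ) := by
  intro ω hω
  have mem : ∀ x y : V, ω ∈ (openConn x y : Set (BondConfig V)) ↔ (openGraph ω).Reachable x y :=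
    fun _ _ => Iff.rfl
  simp only [mem_union, mem_inter_iff, mem_compl_iff, mem] at hω
  simp only [mem_union, mem_sdiff, mem_compl_iff, mem_inter_iff, mem]
  rcases hω with (⟨hac, hbc⟩ | ⟨⟨hoa, hbc⟩, hab⟩) | ⟨⟨hob, hac⟩, hab⟩
  · left
    exact ⟨hac, fun h => hbc h.1.2⟩
  · left
    refine ⟨fun hac => hab (hac.trans hbc.symm), ?_⟩
    rintro ⟨⟨hob, -⟩, -⟩
    exact hab (hoa.symm.trans hob)
  · right
    exact ⟨⟨hob, hac⟩, hab⟩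

/-- `oac|b ⊆ {b ↮ c}`. [folklore] -/
theorem tripodCell_oac_subset (o a b c : V) :
    (openConn o a ∩ openConn a c ∩ (openConn a b)ᶜ : Set (BondConfig V)) ⊆ (openConn b c)ᶜ := by
  rintro ω ⟨⟨-, hac⟩, hab⟩ hbc
  exact hab (SimpleGraph.Reachable.trans hac (SimpleGraph.Reachable.symm hbc))

/-- `obc|a ⊆ {a ↮ c}`. [folklore] -/
theorem tripodCell_obc_subset (o a b c : V) :
    (openConn o b ∩ openConn b c ∩ (openConn a b)ᶜ : Set (BondConfig V)) ⊆ (openConn a c)ᶜ := by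
  rintro ω ⟨⟨-, hbc⟩, hab⟩ hac
  exact hab (SimpleGraph.Reachable.trans hac (SimpleGraph.Reachable.symm hbc))

/-- **Master two-cut inequality (slack form).**  For bond percolation with arbitrary edge
probabilities on a finite vertex type, an observer `o` and relays `a, b, c`: if `μ{a ↮ c} ≤ t` and
`μ{b ↮ c} ≤ t` then `μ( ({a↮c} ∩ {b↮c}) ∪ oa|bc ∪ ob|ac ) ≤ t`, where `oa|bc = {o↔a}∩{b↔c}∩{a↮b}`
and `ob|ac = {o↔b}∩{a↔c}∩{a↮b}` are the two alternating 2+2 cells.  One instance of the tripod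
exchange inequality C⁺ (`tripodExchange`): see the module docstring. [folklore] -/
theorem twoCutMaster_le [Fintype V] (w : Sym2 V → unitInterval) (o a b c : V) (t : ℝ)
    (hac : (prodBernoulli w).real (openConn a c)ᶜ ≤ t)
    (hbc : (prodBernoulli w).real (openConn b c)ᶜ ≤ t) :
    (prodBernoulli w).real
        ((((openConn a c)ᶜ ∩ (openConn b c)ᶜ) ∪ (openConn o a ∩ openConn b c ∩ (openConn a b)ᶜ)) ∪
          (openConn o b ∩ openConn a c ∩ (openConn a b)ᶜ)) ≤ t := by
  classical
  set μ := prodBernoulli w with hμ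
  set L := ((((openConn a c)ᶜ ∩ (openConn b c)ᶜ) ∪
      (openConn o a ∩ openConn b c ∩ (openConn a b)ᶜ)) ∪
        (openConn o b ∩ openConn a c ∩ (openConn a b)ᶜ) : Set (BondConfig V)) with hL
  -- the four cells of C⁺ (x = a, y = b, z = c)
  set E1 := (openConn o a ∩ openConn b c ∩ (openConn a b)ᶜ : Set (BondConfig V)) with hE1
  set E2 := (openConn o b ∩ openConn a c ∩ (openConn a b)ᶜ : Set (BondConfig V)) with hE2
  set E3 := (openConn o a ∩ openConn a c ∩ (openConn a b)ᶜ : Set (BondConfig V)) with hE3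
  set E4 := (openConn o b ∩ openConn b c ∩ (openConn a b)ᶜ : Set (BondConfig V)) with hE4
  have hC : μ.real E1 * μ.real E2 ≤ μ.real E3 * μ.real E4 := tripodExchange w o a b c
  have h1 : μ.real L ≤ μ.real (openConn b c)ᶜ - μ.real E3 + μ.real E1 :=
    calc μ.real L ≤ μ.real (((openConn b c)ᶜ \ E3) ∪ E1) :=
          measureReal_mono (twoCutMaster_subset_left o a b c)
      _ ≤ μ.real ((openConn b c)ᶜ \ E3) + μ.real E1 := measureReal_union_le _ _
      _ = μ.real (openConn b c)ᶜ - μ.real E3 + μ.real E1 := by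
          rw [measureReal_sdiff (tripodCell_oac_subset o a b c) MeasurableSet.of_discrete]
  have h2 : μ.real L ≤ μ.real (openConn a c)ᶜ - μ.real E4 + μ.real E2 :=
    calc μ.real L ≤ μ.real (((openConn a c)ᶜ \ E4) ∪ E2) :=
          measureReal_mono (twoCutMaster_subset_right o a b c)
      _ ≤ μ.real ((openConn a c)ᶜ \ E4) + μ.real E2 := measureReal_union_le _ _
      _ = μ.real (openConn a c)ᶜ - μ.real E4 + μ.real E2 := by
          rw [measureReal_sdiff (tripodCell_obc_subset o a b c) MeasurableSet.of_discrete]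
  have hE3' : 0 ≤ μ.real E3 := measureReal_nonneg
  have hE4' : 0 ≤ μ.real E4 := measureReal_nonneg
  by_contra hlt
  push Not at hlt
  have h31 : μ.real E3 < μ.real E1 := by linarith
  have h42 : μ.real E4 < μ.real E2 := by linarith
  have : μ.real E3 * μ.real E4 < μ.real E1 * μ.real E2 := mul_lt_mul'' h31 h42 hE3' hE4'
  linarith

/-- **Master two-cut inequality (max form).**
`μ( ({a↮c} ∩ {b↮c}) ∪ oa|bc ∪ ob|ac ) ≤ max(μ{a ↮ c}, μ{b ↮ c})`. [folklore] -/
theorem twoCutMaster_le_max [Fintype V] (w : Sym2 V → unitInterval) (o a b c : V) :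
    (prodBernoulli w).real
        ((((openConn a c)ᶜ ∩ (openConn b c)ᶜ) ∪ (openConn o a ∩ openConn b c ∩ (openConn a b)ᶜ)) ∪
          (openConn o b ∩ openConn a c ∩ (openConn a b)ᶜ)) ≤
      max ((prodBernoulli w).real (openConn a c)ᶜ) ((prodBernoulli w).real (openConn b c)ᶜ) :=
  twoCutMaster_le w o a b c _ (le_max_left _ _) (le_max_right _ _)

/-- The heavy-class exit event lies in the master event:
`{o↮c} ∩ ({o↔a} ∪ {o↔b}) ⊆ ({a↮c} ∩ {b↮c}) ∪ oa|bc ∪ ob|ac` — if `o ↔ a` then `a ↮ c`; if moreover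
`b ↔ c` then `o ↮ b` and `a ↮ b`, i.e. the cell `oa|bc`; symmetrically for `o ↔ b`. [folklore] -/
theorem lonelyOrPair_subset_master (o a b c : V) :
    ((openConn o c)ᶜ ∩ (openConn o a ∪ openConn o b) : Set (BondConfig V)) ⊆
      (((openConn a c)ᶜ ∩ (openConn b c)ᶜ) ∪ (openConn o a ∩ openConn b c ∩ (openConn a b)ᶜ)) ∪
        (openConn o b ∩ openConn a c ∩ (openConn a b)ᶜ) := by
  intro ω hω
  have mem : ∀ x y : V, ω ∈ (openConn x y : Set (BondConfig V)) ↔ (openGraph ω).Reachable x y :=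
    fun _ _ => Iff.rfl
  simp only [mem_inter_iff, mem_compl_iff, mem_union, mem] at hω
  simp only [mem_union, mem_inter_iff, mem_compl_iff, mem]
  obtain ⟨hoc, hoa | hob⟩ := hω
  · have hac : ¬ (openGraph ω).Reachable a c := fun h => hoc (hoa.trans h)
    by_cases hbc : (openGraph ω).Reachable b c
    · exact Or.inl (Or.inr ⟨⟨hoa, hbc⟩, fun hab => hoc ((hoa.trans hab).trans hbc)⟩)
    · exact Or.inl (Or.inl ⟨hac, hbc⟩)
  · have hbc : ¬ (openGraph ω).Reachable b c := fun h => hoc (hob.trans h)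
    by_cases hac : (openGraph ω).Reachable a c
    · exact Or.inr ⟨⟨hob, hac⟩, fun hab => hoc ((hob.trans hab.symm).trans hac)⟩
    · exact Or.inl (Or.inl ⟨hac, hbc⟩)

/-- **Heavy-class exit bound (slack form).**  If `μ{a ↮ c} ≤ t` and `μ{b ↮ c} ≤ t` then
`μ( {o ↮ c} ∩ ({o ↔ a} ∪ {o ↔ b}) ) ≤ t`: the probability that `o` reaches `a` or `b` but not `c`
is at most the worse single cut from `c`.  This is sub-case R4b of the four-class one-cut analysis
(observer class without targets, one class `c` carrying more than half of the target mass: on the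
minority event `o` misses `c` and meets one of the two light classes).  Monotone corollary of
`twoCutMaster_le`. [folklore] -/
theorem lonelyOrPair_le [Fintype V] (w : Sym2 V → unitInterval) (o a b c : V) (t : ℝ)
    (hac : (prodBernoulli w).real (openConn a c)ᶜ ≤ t)
    (hbc : (prodBernoulli w).real (openConn b c)ᶜ ≤ t) :
    (prodBernoulli w).real ((openConn o c)ᶜ ∩ (openConn o a ∪ openConn o b)) ≤ t :=
  (measureReal_mono (lonelyOrPair_subset_master o a b c)).trans (twoCutMaster_le w o a b c t hac hbc)

/-- **Heavy-class exit bound (max form).**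
`μ( {o ↮ c} ∩ ({o ↔ a} ∪ {o ↔ b}) ) ≤ max(μ{a ↮ c}, μ{b ↮ c})`. [folklore] -/
theorem lonelyOrPair_le_max [Fintype V] (w : Sym2 V → unitInterval) (o a b c : V) :
    (prodBernoulli w).real ((openConn o c)ᶜ ∩ (openConn o a ∪ openConn o b)) ≤
      max ((prodBernoulli w).real (openConn a c)ᶜ) ((prodBernoulli w).real (openConn b c)ᶜ) :=
  lonelyOrPair_le w o a b c _ (le_max_left _ _) (le_max_right _ _)

end Summit.CriticalPhenomena.PercolationContinuityZ3.Theorems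

end
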